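import Literature.IUT.LogThetaLattice.BiCores
import Literature.IUT.LogThetaLattice.PerpPrimeStrips
import Literature.IUT.LogThetaLattice.LogLinkIterates
import Literature.IUT.LogThetaLattice.LogWallRemarks
import Literature.IUT.LogThetaLattice.ThetaMonoids
import Literature.IUT.LogThetaLattice.MultiradialityRemarks
import Literature.IUT.LogThetaLattice.PilotWeights
import Literature.IUT.LogThetaLattice.GlobalPacketsLGP
import Literature.IUT.LogThetaLattice.ThetaPilotObjects
import Literature.IUT.LogThetaLattice.PacketLogVolumes
import Literature.IUT.LogThetaLattice.HolomorphicHullBridge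
import Literature.IUT.HodgeArakelov.ExpositoryRemarks
import Literature.IUT.HodgeArakelov.GaloisPairRigidity
import Literature.IUT.HodgeTheaters.ThetaHodgeTheatersRemarksA2
import Literature.IUT.HodgeTheaters.GlobalFrobenioidsKummer
import Literature.IUT.HodgeTheaters.FPrimeStripsCoric
import Literature.IUT.HodgeTheaters.PMTheatersLabelRemarks
import Literature.IUT.LogVolume.RemarksCor23Proofs
import Literature.AnabelianGeometry.AbsoluteAnabelian.MonoidKummerMaps
import Literature.AnabelianGeometry.AbsoluteAnabelian.MonoidKummerMapsProofs
import Summits.ABC.IUTFork.Thm311Remarks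

/-!
# Kernel DAG index — layer C312, part k: node blocks for the Cor-3.12 PINS that are LANDED but not yet indexed

index v1 · abc-iut-c312-2 (filer, gen 2) per HOME/plan/KERNEL-DAG-SPEC.md v1.3 §2(a)–(d); HAND-WRITTEN (like c312-8's `DAGC312rem`)
because the machine delta drafts (plan/kernel-draft @22:20Z) no longer emit these rows (their `decls` resolve as `p0:`/empty in
plan/DAG.tsv), while the L6 lead's pin list (plan/L6/COR312-PINS.md v1.3: 78/81 Cor-3.12 pins landed) and the typers' `**<node_id>**`
docstring tags name the landed declarations. One block per DAG row cited INSIDE the statement/proof of [IUTchIII] Cor. 3.12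
(`Cor312Proof.Locus`, 85 loci) whose statement has landed and which had no `N_<kernel_id>` in the tree; kernel_ids verbatim from
plan/DAG.tsv. Encoding per spec: DATA / predicate / slot-index rows ↦ `abbrev N_<id> := @<primary decl>` (+ `example := @…` per further
decl); CLAIM rows ↦ `def/abbrev N_<id> : Prop := StatementOf @thm ∧ …` with `_holds` iff the row is `discharged(p)`, `_part` if `landed(p)`.
The knitting of these nodes into the loci readings is the separate part `DAGC312l` (delta 4).
THIS FILE PROVES NOTHING NEW AND ASSERTS NOTHING; no side taken on [IUTchIII] Cor. 3.12. typed ≠ discharged; indexed ≠ endorsed.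
[claim: Mochizuki2012, status: disputed]
-/

namespace Summit.ABC.IUTFork.DAG

namespace PartC312k
/-- `StatementOf h` is the statement (a `Prop`) of which the landed `h` is the proof: the index NAMES statements, it never re-types them. -/
abbrev StatementOf {P : Prop} (_h : P) : Prop := P
end PartC312k
open PartC312k

noncomputable section
universe u₁ u₂ u₃ u₄ u₅ u₆

/-! ## [IUTchIII] §1–§2 pins (owner abc-iut-L6-t3) -/

/-- [node IUTchIII:Thm1.5(iii) · L6/D3 · [IUTchIII] Thm 1.5 (iii), kurims p.48 l.51 · p406839 `BiCores` · claim · DAG status landed(p406839)]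
"Bi-coric F⊢×μ-prime-strips": vertical/horizontal/bi-coric poly-isomorphisms and their naturality. Cited at Steps (iv), (v), (vii).
decls: `BiCoricData.mapIso_eq_conj`, `mem_horizontalPolyIso`, `verticalPolyIso_subset`, `biCoricPolyIso_subset` (+ data). -/
def N_IUTchIII_Thm1_5_iii : Prop :=
  StatementOf @Literature.IUT.LogThetaLattice.BiCoricData.mapIso_eq_conj.{u₁} ∧
  StatementOf @Literature.IUT.LogThetaLattice.BiCoricData.mem_horizontalPolyIso.{u₁} ∧
  StatementOf @Literature.IUT.LogThetaLattice.BiCoricData.verticalPolyIso_subset.{u₁} ∧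
  StatementOf @Literature.IUT.LogThetaLattice.BiCoricData.biCoricPolyIso_subset.{u₁}
/-- partial witness (DAG row not marked discharged) of `N_IUTchIII_Thm1_5_iii`: BY NAME; proves nothing new. -/
theorem N_IUTchIII_Thm1_5_iii_part : N_IUTchIII_Thm1_5_iii :=
  ⟨@Literature.IUT.LogThetaLattice.BiCoricData.mapIso_eq_conj, @Literature.IUT.LogThetaLattice.BiCoricData.mem_horizontalPolyIso,
   @Literature.IUT.LogThetaLattice.BiCoricData.verticalPolyIso_subset, @Literature.IUT.LogThetaLattice.BiCoricData.biCoricPolyIso_subset⟩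
example := @Literature.IUT.LogThetaLattice.BiCoricData.verticalPolyIso
example := @Literature.IUT.LogThetaLattice.BiCoricData.horizontalPolyIso
example := @Literature.IUT.LogThetaLattice.BiCoricData.biCoricPolyIso
example := @Literature.IUT.LogThetaLattice.BiCoricData.kummerAt
example := @Literature.IUT.LogThetaLattice.BiCoricData.kummerTransport

/-- [node IUTchIII:Thm1.5(iv) · L6/D3 · [IUTchIII] Thm 1.5 (iv), kurims p.50 l.18 · p406839 `BiCores` · claim · DAG status landed(p406839)]
"Bi-coric mono-analytic log-shells". Cited at Steps (iv), (v), (vii). decls: `BiCoricData.monoShellOfDeltaAt_nonempty` (+ data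
`biCoricShellPolyIso`, `dvIso`, `monoShellOfDeltaAt`, `shellKummerAt`). -/
abbrev N_IUTchIII_Thm1_5_iv : Prop := StatementOf @Literature.IUT.LogThetaLattice.BiCoricData.monoShellOfDeltaAt_nonempty.{u₁}
/-- partial witness (DAG row not marked discharged) of `N_IUTchIII_Thm1_5_iv`: BY NAME; proves nothing new. -/
theorem N_IUTchIII_Thm1_5_iv_part : N_IUTchIII_Thm1_5_iv := @Literature.IUT.LogThetaLattice.BiCoricData.monoShellOfDeltaAt_nonempty
example := @Literature.IUT.LogThetaLattice.BiCoricData.biCoricShellPolyIso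
example := @Literature.IUT.LogThetaLattice.BiCoricData.dvIso
example := @Literature.IUT.LogThetaLattice.BiCoricData.monoShellOfDeltaAt
example := @Literature.IUT.LogThetaLattice.BiCoricData.shellKummerAt

/-- [node IUTchIII:Def2.4(iii) · L6/D3 · [IUTchIII] Def 2.4 (iii), kurims p.88 l.49 · p405292 `PerpPrimeStrips` · data · DAG status discharged(p405292)]
`F^{⊩▶}`-prime-strips (quadruples). Cited at Step (i). -/
abbrev N_IUTchIII_Def2_4_iii := @Literature.IUT.LogThetaLattice.GlQuadruple
example := @Literature.IUT.LogThetaLattice.GlQuadruple.frob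
example := @Literature.IUT.LogThetaLattice.GlQuadruple.strip
example := @Literature.IUT.LogThetaLattice.GlQuadruple.hom_ρ_comm
example := @Literature.IUT.LogThetaLattice.GlStripCat
example := @Literature.IUT.LogThetaLattice.GlStripCat.iso_nonempty
example := @Literature.IUT.LogThetaLattice.FglPerpStrip
example := @Literature.IUT.LogThetaLattice.FglTriStrip

/-- [node IUTchIII:Rmk1.2.2(iii) · L6/D3 · [IUTchIII] Rmk 1.2.2 (iii)(a), kurims p.36 l.52 · p404701 `LogLinkIterates` + p404659 `LogWallRemarks`
· claim · DAG status discharged(p404701)] structures invariant under the vertical shifts; upper semi-commutativity. Cited at Step (iv). -/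
def N_IUTchIII_Rmk1_2_2_iii : Prop :=
  StatementOf @Literature.IUT.LogThetaLattice.iterate_image_subset_logShell.{u₁} ∧
  StatementOf @Literature.IUT.LogThetaLattice.UpperSemiCommutative.iUnion_subset.{u₁}
/-- discharge of `N_IUTchIII_Rmk1_2_2_iii`: BY NAME; proves nothing new. -/
theorem N_IUTchIII_Rmk1_2_2_iii_holds : N_IUTchIII_Rmk1_2_2_iii :=
  ⟨@Literature.IUT.LogThetaLattice.iterate_image_subset_logShell, @Literature.IUT.LogThetaLattice.UpperSemiCommutative.iUnion_subset⟩
example := @Literature.IUT.LogThetaLattice.UpperSemiCommutative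
example := @Literature.IUT.LogThetaLattice.iterate_image_subset_preLogShell

/-- [node IUTchIII:Rmk1.3.2 · L6/D3 · [IUTchIII] Rmk 1.3.2, kurims p.43 l.43 · p404659 `LogWallRemarks` · predicate · DAG status discharged(p404659)]
compatibility of the `F^{⋊±}_l`-conjugate synchronization with the log-link (typed as a named predicate). Cited at Step (vi). -/
abbrev N_IUTchIII_Rmk1_3_2 := @Literature.IUT.LogThetaLattice.Rmk132_logLinkCompatible

/-- [node IUTchIII:Rmk1.5.4(i) · L6/D3 · [IUTchIII] Rmk 1.5.4 (i), kurims p.56 l.3 · p406839 `BiCores` · data · DAG status discharged(p406839)]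
the two kinds of indeterminacy (Kummer-detachment / étale-transport). Cited at Steps (v), (x). -/
abbrev N_IUTchIII_Rmk1_5_4_i := @Literature.IUT.LogThetaLattice.IndeterminacyKind

/-- [node IUTchIII:Rmk2.1.1(i) · L6/D3 · [IUTchIII] Rmk 2.1.1 (i), kurims p.61 · p405523 `ThetaMonoids` · data · DAG status discharged(p405523)]
the rigidity properties of mono-theta environments (enumeration). Cited at Step (x). -/
abbrev N_IUTchIII_Rmk2_1_1_i := @Literature.IUT.LogThetaLattice.MonoThetaRigidity

/-- [node IUTchIII:Rmk2.1.1(ii) · L6/D3 · [IUTchIII] Rmk 2.1.1 (ii), kurims p.62 l.2 · p404906 `MultiradialityRemarks` · slot index · DAG status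
discharged(p404906)] "isomorphism class compatibility" — slot `Rmk211Index.ii` (G2: slot-only, not mathematical content). Cited at (vi), (x). -/
abbrev N_IUTchIII_Rmk2_1_1_ii := @Literature.IUT.LogThetaLattice.MultiradialityRemarks.Rmk211Index.ii
/-- [node IUTchIII:Rmk2.1.1(iii) · L6/D3 · [IUTchIII] Rmk 2.1.1 (iii), kurims p.62 l.36 · p404906 · slot index · DAG status discharged(p404906)]
"constant multiple rigidity" — slot `Rmk211Index.iii`. Cited at Step (x). -/
abbrev N_IUTchIII_Rmk2_1_1_iii := @Literature.IUT.LogThetaLattice.MultiradialityRemarks.Rmk211Index.iii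

/-- [node IUTchIII:Rmk2.1.1(iv) · L6/D3 · [IUTchIII] Rmk 2.1.1 (iv), kurims p.62 l.43 · p404443/p404906 · predicate · DAG status discharged(p404443)]
cyclotomic rigidity (contrast with `N`-th power morphisms), typed as a named predicate. Cited at Steps (x), (xi-h). -/
abbrev N_IUTchIII_Rmk2_1_1_iv := @Literature.IUT.LogThetaLattice.MultiradialityRemarks.Rmk211iv_contrast

/-- [node IUTchIII:Rmk2.1.1(v) · L6/D3 · [IUTchIII] Rmk 2.1.1 (v), kurims p.63 l.20 · p404443/p404906 · claim · DAG status discharged(p404443)]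
discrete rigidity: `−1` as a limit of the positive approximants `p^n − 1`. Cited at Steps (vi), (x). -/
def N_IUTchIII_Rmk2_1_1_v : Prop :=
  StatementOf @Literature.IUT.LogThetaLattice.MultiradialityRemarks.Rmk211v_negOne_limit_of_positives ∧
  StatementOf @Literature.IUT.LogThetaLattice.MultiradialityRemarks.Rmk211v_approximants_pos
/-- discharge of `N_IUTchIII_Rmk2_1_1_v`: BY NAME; proves nothing new. -/
theorem N_IUTchIII_Rmk2_1_1_v_holds : N_IUTchIII_Rmk2_1_1_v :=
  ⟨@Literature.IUT.LogThetaLattice.MultiradialityRemarks.Rmk211v_negOne_limit_of_positives,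
   @Literature.IUT.LogThetaLattice.MultiradialityRemarks.Rmk211v_approximants_pos⟩

/-- [node IUTchIII:Rmk2.2.2(iii) · L6/D3 · [IUTchIII] Rmk 2.2.2 (iii), kurims p.70 l.47 · p404906 · claim · DAG status discharged(p404906)]
Galois evaluation (case of Thm 3.11 (ii)(b)): `q`-powers are not torsion. Cited at Step (vi). -/
abbrev N_IUTchIII_Rmk2_2_2_iii : Prop :=
  StatementOf @Literature.IUT.LogThetaLattice.MultiradialityRemarks.Rmk222iii_qPow_not_torsion.{u₁}
/-- discharge of `N_IUTchIII_Rmk2_2_2_iii`: BY NAME; proves nothing new. -/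
theorem N_IUTchIII_Rmk2_2_2_iii_holds : N_IUTchIII_Rmk2_2_2_iii :=
  @Literature.IUT.LogThetaLattice.MultiradialityRemarks.Rmk222iii_qPow_not_torsion

/-- [node IUTchIII:Rmk2.3.2 · L6/D3 · [IUTchIII] Rmk 2.3.2, kurims p.75 l.36 · p404906/p406648 · predicate · DAG status discharged(p406648)]
Galois evaluation (case of Thm 3.11 (ii)(c)); the number-field analogue, typed as a named predicate. Cited at Fig. 3.6, Step (vi). -/
abbrev N_IUTchIII_Rmk2_3_2 := @Literature.IUT.LogThetaLattice.MultiradialityRemarks.Rmk232_numberFieldAnalogue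

/-- [node IUTchIII:Rmk2.4.2(iv) · L6/D3 · [IUTchIII] Rmk 2.4.2 (iv), kurims p.90 l.8 · p403774 `PilotWeights` · claim · DAG status discharged(p403774)]
the submonoids `M▶_v` and the displayed formula `ρ_{M▶_v}(η_{M_v}) = r▶_v · η_M`. Cited in the opening ¶. -/
def N_IUTchIII_Rmk2_4_2_iv : Prop :=
  StatementOf @Literature.IUT.LogThetaLattice.PlaceWeights.rho_eta.{u₁} ∧
  StatementOf @Literature.IUT.LogThetaLattice.PlaceWeights.MTri_non_bijective.{u₁} ∧
  StatementOf @Literature.IUT.LogThetaLattice.PlaceWeights.mem_MTri_arc_iff.{u₁}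
/-- discharge of `N_IUTchIII_Rmk2_4_2_iv`: BY NAME; proves nothing new. -/
theorem N_IUTchIII_Rmk2_4_2_iv_holds : N_IUTchIII_Rmk2_4_2_iv :=
  ⟨@Literature.IUT.LogThetaLattice.PlaceWeights.rho_eta, @Literature.IUT.LogThetaLattice.PlaceWeights.MTri_non_bijective,
   @Literature.IUT.LogThetaLattice.PlaceWeights.mem_MTri_arc_iff⟩
example := @Literature.IUT.LogThetaLattice.PlaceWeights.MTri
example := @Literature.IUT.LogThetaLattice.PlaceWeights.nonposReal

/-- [node IUTchIII:Rmk2.4.2(v) · L6/D3 · [IUTchIII] Rmk 2.4.2 (v), kurims p.90 l.35 · p405292 `PerpPrimeStrips` · data · DAG status discharged(p405292)]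
`Pic`-data of the realified Frobenioids. Cited in the opening ¶. -/
abbrev N_IUTchIII_Rmk2_4_2_v := @Literature.IUT.LogThetaLattice.PicData

/-- [node IUTchIII:Rmk2.4.2(vi) · L6/D3 · [IUTchIII] Rmk 2.4.2 (vi), kurims p.91 l.9 · p404443/p404906 · predicate · DAG status discharged(p404443)]
possible images interpretable as `F^{⊩▶}`-prime-strips in a common container, typed as a named predicate. Cited in the opening ¶. -/
abbrev N_IUTchIII_Rmk2_4_2_vi := @Literature.IUT.LogThetaLattice.MultiradialityRemarks.Rmk242vi_commonContainer

/-! ## [IUTchIII] §3 pins (owner abc-iut-L6-t4) -/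

/-- [node IUTchIII:Prop3.4(ii) · L6/D3 · [IUTchIII] Prop 3.4 (ii), kurims p.102 l.20 · p403901 `GlobalPacketsLGP` · data (output signature) · DAG
status landed(p403901)] local LGP-monoids and their Kummer theory. Cited at Fig. 3.6, Step (vi). -/
abbrev N_IUTchIII_Prop3_4_ii := @Literature.IUT.LogThetaLattice.LGPMonoidSignature
example := @Literature.IUT.LogThetaLattice.LGPMonoidSignature.smul_mem_IQ

/-- [node IUTchIII:Prop3.7(i) · L6/D3 · [IUTchIII] Prop 3.7 (i), kurims p.109 l.54 · p403954 `ThetaPilotObjects` · data (output signature) · DAG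
status landed(p403954)] local copies of `F_mod` and their Kummer theory (global packet-theoretic Frobenioids). Cited at Fig. 3.6. -/
abbrev N_IUTchIII_Prop3_7_i := @Literature.IUT.LogThetaLattice.GlobalLGPFrobenioidSignature

/-- [node IUTchIII:Prop3.9(ii) · L6/D3 · [IUTchIII] Prop 3.9 (ii), kurims p.116 l.28 · p404053 `PacketLogVolumes` · predicate · DAG status
landed(p404053)] "Mono-analytic Compatibility" of the log-volumes, typed as a named predicate. Cited in the statement and at Step (x). -/
abbrev N_IUTchIII_Prop3_9_ii := @Literature.IUT.LogThetaLattice.Prop39ii_monoAnalyticCompat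

/-- [node IUTchIII:Prop3.9(iii) · L6/D3 · [IUTchIII] Prop 3.9 (iii), kurims p.117 l.8 · p404053 `PacketLogVolumes` · predicates + data · DAG status
landed(p404053)] "Global Compatibility": global log-volumes, invariance, degrees as log-volumes. Cited at Step (xi-d). -/
abbrev N_IUTchIII_Prop3_9_iii := @Literature.IUT.LogThetaLattice.Prop39iii_invariance
example := @Literature.IUT.LogThetaLattice.Prop39iii_degree
example := @Literature.IUT.LogThetaLattice.GlobalRegion
example := @Literature.IUT.LogThetaLattice.globalLogVolume

/-- [node IUTchIII:Prop3.9(iv) · L6/D3 · [IUTchIII] Prop 3.9 (iv), kurims p.117 l.49 · p404053 `PacketLogVolumes` · predicates · DAG status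
landed(p404053)] "log-link Compatibility" (a), (b), typed as named predicates. Cited at Step (x). -/
abbrev N_IUTchIII_Prop3_9_iv := @Literature.IUT.LogThetaLattice.Prop39iv_a
example := @Literature.IUT.LogThetaLattice.Prop39iv_b

/-- [node IUTchIII:Rmk3.9.2 · L6/D3 · [IUTchIII] Rmk 3.9.2, kurims p.119 l.46 · p404053 · predicate · DAG status discharged(p404053)] mono-analytic
recovery of the nonnegative subquotient (degrees vs log-volumes), typed as a named predicate. Cited at Step (xi-d). -/
abbrev N_IUTchIII_Rmk3_9_2 := @Literature.IUT.LogThetaLattice.Remark392_nonnegAt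

/-- [node IUTchIII:Rmk3.9.3 · L6/D3 · [IUTchIII] Rmk 3.9.3, kurims p.119 l.59 · p404053 · claim · DAG status discharged(p404053)] no more general
weighted averages over `j` (equal weights forced). Cited at Step (x). -/
abbrev N_IUTchIII_Rmk3_9_3 : Prop := StatementOf @Literature.IUT.LogThetaLattice.Remark393_equalWeights
/-- discharge of `N_IUTchIII_Rmk3_9_3`: BY NAME; proves nothing new. -/
theorem N_IUTchIII_Rmk3_9_3_holds : N_IUTchIII_Rmk3_9_3 := @Literature.IUT.LogThetaLattice.Remark393_equalWeights

/-- [node IUTchIII:Rmk3.9.5(viii) · L6/D3 · [IUTchIII] Rmk 3.9.5 (viii), kurims p.139 l.18 · p405001 `HolomorphicHullBridge` · slot index · DAG status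
discharged(p405001)] (sQ4) etc. — slot `Remark395viiiIndex` (G2: slot-only). Cited at Step (xi-d) (twice). -/
abbrev N_IUTchIII_Rmk3_9_5_viii := @Literature.IUT.LogThetaLattice.Remark395viiiIndex

/-- [node IUTchIII:Rmk3.9.6 · L6/D3 · [IUTchIII] Rmk 3.9.6, kurims p.145 l.24 · p404053 · claim · DAG status discharged(p404053)] compatibility of
"product formulas" under the log-link. Cited in the opening ¶ and at Step (xi-d). -/
abbrev N_IUTchIII_Rmk3_9_6 : Prop := StatementOf @Literature.IUT.LogThetaLattice.Remark396_productFormulaCompat.{u₁, u₂}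
/-- discharge of `N_IUTchIII_Rmk3_9_6`: BY NAME; proves nothing new. -/
theorem N_IUTchIII_Rmk3_9_6_holds : N_IUTchIII_Rmk3_9_6 := @Literature.IUT.LogThetaLattice.Remark396_productFormulaCompat

/-- [node IUTchIII:Rmk3.9.7(i) · L6/D3 · [IUTchIII] Rmk 3.9.7 (i), kurims p.145 l.43 · p404053 · claim · DAG status discharged(p404053)] the shell
family is a global region. Cited in the opening ¶. -/
abbrev N_IUTchIII_Rmk3_9_7_i : Prop := StatementOf @Literature.IUT.LogThetaLattice.Remark397i_shellFamily_isGlobal.{u₁, u₂}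
/-- discharge of `N_IUTchIII_Rmk3_9_7_i`: BY NAME; proves nothing new. -/
theorem N_IUTchIII_Rmk3_9_7_i_holds : N_IUTchIII_Rmk3_9_7_i := @Literature.IUT.LogThetaLattice.Remark397i_shellFamily_isGlobal
/-- [node IUTchIII:Rmk3.9.7(ii) · L6/D3 · [IUTchIII] Rmk 3.9.7 (ii), kurims p.146 l.16 · p404053 · data · DAG status discharged(p404053)] log-volumes
of relatively compact subsets. Cited in the opening ¶. -/
abbrev N_IUTchIII_Rmk3_9_7_ii := @Literature.IUT.LogThetaLattice.logVolumeOfRelCompact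
example := @Literature.IUT.LogThetaLattice.logVolumeOfRelCompact_mono
/-- [node IUTchIII:Rmk3.9.7(iii) · L6/D3 · [IUTchIII] Rmk 3.9.7 (iii), kurims p.146 l.31 · p404053 · data · DAG status discharged(p404053)] global
log-volume of a collection of regions. Cited in the opening ¶. -/
abbrev N_IUTchIII_Rmk3_9_7_iii := @Literature.IUT.LogThetaLattice.globalLogVolumeOfCollection

/-! ## [IUTchIII] Remarks 3.11.x pins (owner abc-iut-c312-1, `Thm311Remarks` p404942) -/

/-- [node IUTchIII:Rmk3.11.1(ii) · C312/D3 · [IUTchIII] Rmk 3.11.1 (ii), kurims p.159 l.26 · p404942 `Thm311Remarks` · claim · DAG status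
discharged(p404942)] functoriality in the input prime-strip: the output class `R^LGP` is invariant under the indeterminacy moves. Cited at (xi-b). -/
abbrev N_IUTchIII_Rmk3_11_1_ii : Prop := StatementOf @Summit.ABC.IUTFork.Thm311.MRData.RLGP_map_eq
/-- discharge of `N_IUTchIII_Rmk3_11_1_ii`: BY NAME; proves nothing new. -/
theorem N_IUTchIII_Rmk3_11_1_ii_holds : N_IUTchIII_Rmk3_11_1_ii := @Summit.ABC.IUTFork.Thm311.MRData.RLGP_map_eq

/-- [node IUTchIII:Rmk3.11.1(iii) · C312/D3 · [IUTchIII] Rmk 3.11.1 (iii), kurims p.160 l.30 (IPL) / p.161 l.23 (SHE) · p404942 · predicate ·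
DAG status discharged(p410265)] (IPL) typed as the READING `LinkData.IPL` (with LANA Rem. 8.2.1's vacuity lemma `ipl_iff_nonempty`); (SHE)
NOTED by the owner (kernel shadow only). Cited in the opening ¶ and at Steps (xi-b)–(xi-e). -/
abbrev N_IUTchIII_Rmk3_11_1_iii := @Summit.ABC.IUTFork.Thm311.LinkData.IPL
example := @Summit.ABC.IUTFork.Thm311.LinkData.ipl_iff_nonempty
example := @Summit.ABC.IUTFork.Thm311.LinkData.ipl_of_connected

/-- [node IUTchIII:Rmk3.11.2(ii) · C312/D3 · [IUTchIII] Rmk 3.11.2 (ii), kurims p.167 l.16 · `Thm311Remarks` · claim · DAG status discharged(tree)]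
labels vs naked index sets: `j+1` possibilities, `(l⋇+1)! = l^±!`. Cited at Step (vii). -/
abbrev N_IUTchIII_Rmk3_11_2_ii : Prop := StatementOf @Summit.ABC.IUTFork.Thm311.labelIdentifications_card
/-- discharge of `N_IUTchIII_Rmk3_11_2_ii`: BY NAME; proves nothing new. -/
theorem N_IUTchIII_Rmk3_11_2_ii_holds : N_IUTchIII_Rmk3_11_2_ii := @Summit.ABC.IUTFork.Thm311.labelIdentifications_card
example := @Summit.ABC.IUTFork.Thm311.lpm_eq

/-! ## [IUTchII] pins (owners abc-iut-L6-t1/t2) -/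

/-- [node IUTchII:Cor1.11 · L6/D2 · [IUTchII] Cor 1.11, kurims p.49 · p409065 `GaloisPairRigidity` · claim · DAG status landed(p409065)] MLF-Galois
pair cyclotomic rigidity (a): multiradially defined. Cited at Step (vi). -/
abbrev N_IUTchII_Cor1_11 : Prop := StatementOf @Literature.IUT.HodgeArakelov.cor111_multiradiallyDefined.{u₁}
/-- partial witness (DAG row not marked discharged) of `N_IUTchII_Cor1_11`: BY NAME; proves nothing new. -/
theorem N_IUTchII_Cor1_11_part : N_IUTchII_Cor1_11 := @Literature.IUT.HodgeArakelov.cor111_multiradiallyDefined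
example := @Literature.IUT.HodgeArakelov.GaloisPairRigidityData
example := @Literature.IUT.HodgeArakelov.GaloisPairRigidityData.orbitA
example := @Literature.IUT.HodgeArakelov.GaloisPairRigidityData.orbitB

/-- [node IUTchII:Rmk1.11.1(i) · L6/D2 · [IUTchII] Rmk 1.11.1 (i)(a)–(d), kurims p.49 · p409065 · predicates · DAG status discharged(p409065)] -/
abbrev N_IUTchII_Rmk1_11_1_i := @Literature.IUT.HodgeArakelov.Rmk1111_a
example := @Literature.IUT.HodgeArakelov.Rmk1111_b
example := @Literature.IUT.HodgeArakelov.Rmk1111_c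
example := @Literature.IUT.HodgeArakelov.Rmk1111_d
example := @Literature.IUT.HodgeArakelov.PairAut

/-- [node IUTchII:Rmk1.11.3(ii) · L6/D2 · [IUTchII] Rmk 1.11.3 (ii), kurims p.52 · p409065 · claim (helper) · DAG status discharged(p409065)]
uniqueness of the induced automorphism of `O^×(G)` through `O^×(G) ↪ O^ĝp(G)`. Cited at Step (vi). -/
abbrev N_IUTchII_Rmk1_11_3_ii : Prop := StatementOf @Literature.IUT.HodgeArakelov.unitsAut_unique_of_Oghat.{u₁}
/-- discharge of `N_IUTchII_Rmk1_11_3_ii`: BY NAME; proves nothing new. -/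
theorem N_IUTchII_Rmk1_11_3_ii_holds : N_IUTchII_Rmk1_11_3_ii := @Literature.IUT.HodgeArakelov.unitsAut_unique_of_Oghat

/-- [node IUTchII:Rmk3.6.4(i) · L6/D2 · [IUTchII] Rmk 3.6.4 (i), kurims p.105 · p404249 `ExpositoryRemarks` · slot · DAG status discharged(p404249)]
rigidity under isomorphism indeterminacy; no Kummer towers — slot `Remark364.rigidityUnderIsomorphismIndeterminacy`. Cited at Step (vi). -/
abbrev N_IUTchII_Rmk3_6_4_i := @Literature.IUT.HodgeArakelov.Remark364.rigidityUnderIsomorphismIndeterminacy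
/-- [node IUTchII:Rmk3.6.4(iii) · L6/D2 · [IUTchII] Rmk 3.6.4 (iii), kurims p.106 l.43 · p404249 · slot · DAG status discharged(p404249)] Galois
evaluation is linear; the first power — slot `Remark364.galoisEvaluationLinear`. Cited at Step (xi-h). -/
abbrev N_IUTchII_Rmk3_6_4_iii := @Literature.IUT.HodgeArakelov.Remark364.galoisEvaluationLinear
/-- [node IUTchII:Rmk3.6.4(iv) · L6/D2 · [IUTchII] Rmk 3.6.4 (iv), kurims p.107 l.14 · p404249 · slot · DAG status discharged(p404249)] first power
only (`N`-th powers of Θ-pilots) — slot `Remark364.firstPowerOnly`. Cited at Step (xi-h). -/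
abbrev N_IUTchII_Rmk3_6_4_iv := @Literature.IUT.HodgeArakelov.Remark364.firstPowerOnly

/-- [node IUTchII:Rmk4.5.3(iii) · L6/D2 · [IUTchII] Rmk 4.5.3 (iii), kurims p.136 l.23 · p404249 · slot · DAG status discharged(p404249)] gluing the
local `F_l^⋊±`-symmetries — slot `Remark453.globalPlusMinusSynchronization`. Cited at Step (viii). -/
abbrev N_IUTchII_Rmk4_5_3_iii := @Literature.IUT.HodgeArakelov.Remark453.globalPlusMinusSynchronization

/-- [node IUTchII:Rmk4.11.2(iii) · L6/D2 · [IUTchII] Rmk 4.11.2 (iii), kurims p.166 l.28 · p404249 · slot · DAG status discharged(p404249)] the role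
of number fields — slot `Remark4112.numberFieldRole`. Cited at Step (viii). -/
abbrev N_IUTchII_Rmk4_11_2_iii := @Literature.IUT.HodgeArakelov.Remark4112.numberFieldRole
/-- [node IUTchII:Rmk4.11.2(iv) · L6/D2 · [IUTchII] Rmk 4.11.2 (iv), kurims p.167 l.14 · p404249 · slot · DAG status discharged(p404249)] parallel
treatment by dismantling — slot `Remark4112.dismantling`. Cited at Step (v). -/
abbrev N_IUTchII_Rmk4_11_2_iv := @Literature.IUT.HodgeArakelov.Remark4112.dismantling

/-! ## [IUTchI] pins (owners abc-iut-L5-t2/t4/t6) -/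

/-- [node IUTchI:Rmk3.4.2 · L5/D2 · [IUTchI] Rmk 3.4.2, kurims p.82 · p405380 `ThetaHodgeTheatersRemarksA2` · predicate · DAG status
discharged(p405380)] Kummer structures recoverable via co-holomorphicizations at `v ∈ V^arc`, typed as a named predicate. Cited at Step (vi). -/
abbrev N_IUTchI_Rmk3_4_2 := @Literature.IUT.HodgeTheaters.KummerStructureRecoverable

/-- [node IUTchI:Ex5.1(v) · L5/D2 · [IUTchI] Ex 5.1 (v), kurims p.127 · p405210 `GlobalFrobenioidsKummer` · claim · DAG status landed(p405210)]
`∞κ`-coric / `∞κ×`-coric structures: existence (uniqueness typed as a structure). Cited at Steps (ii), (vi). -/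
abbrev N_IUTchI_Ex5_1_v : Prop := StatementOf @Literature.IUT.HodgeTheaters.exists_coricStructure.{u₁}
/-- partial witness (DAG row not marked discharged) of `N_IUTchI_Ex5_1_v`: BY NAME; proves nothing new. -/
theorem N_IUTchI_Ex5_1_v_part : N_IUTchI_Ex5_1_v := @Literature.IUT.HodgeTheaters.exists_coricStructure
example := @Literature.IUT.HodgeTheaters.CoricPair
example := @Literature.IUT.HodgeTheaters.IsCoricStructure
example := @Literature.IUT.HodgeTheaters.ExistsUniqueCoricStructure

/-- [node IUTchI:Def5.2(vi) · L5/D2 · [IUTchI] Def 5.2 (vi), kurims p.138 · p410415 `FPrimeStripsCoric` · data · DAG status discharged(p410415)]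
the `∞κ`-coric structure determined by an `∞κ×`-coric structure. Cited at Steps (ii), (vi). -/
abbrev N_IUTchI_Def5_2_vi := @Literature.IUT.HodgeTheaters.PMBaseKit.CoricKit.infkOfInfkx
example := @Literature.IUT.HodgeTheaters.PMBaseKit.CoricKit.infkOfInfkx_eq
/-- [node IUTchI:Def5.2(viii) · L5/D2 · [IUTchI] Def 5.2 (viii), kurims p.140 · p410415 · data · DAG status discharged(p410415)] the cyclotome
`μ^Θ_Ẑ(‡𝒟_v)` and the Kummer structure cyclotomic isomorphism. Cited at Steps (ii), (vi). -/
abbrev N_IUTchI_Def5_2_viii := @Literature.IUT.HodgeTheaters.PMBaseKit.CoricKit.cyclotome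
example := @Literature.IUT.HodgeTheaters.PMBaseKit.CoricKit.kummerCyclotomicIso

/-- [node IUTchI:Rmk6.12.4(iii) · L5/D2 · [IUTchI] Rmk 6.12.4 (iii), kurims p.179 · p405059 `PMTheatersLabelRemarks` · claim · DAG status
discharged(p405059)] the additive action of `𝔽_l` is not compatible with `𝔽_l ↠ |𝔽_l|`. Cited at Step (viii). -/
abbrev N_IUTchI_Rmk6_12_4_iii : Prop := StatementOf @Literature.IUT.HodgeTheaters.Rmk6124.transl_not_compatible_flAbs
/-- discharge of `N_IUTchI_Rmk6_12_4_iii`: BY NAME; proves nothing new. -/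
theorem N_IUTchI_Rmk6_12_4_iii_holds : N_IUTchI_Rmk6_12_4_iii :=
  @Literature.IUT.HodgeTheaters.Rmk6124.transl_not_compatible_flAbs
example := @Literature.IUT.HodgeTheaters.Rmk6124.units_mul_compatible_flAbs

/-! ## [IUTchIV] and [AbsTopIII] pins (owners campaign S / abc-iut-L4) -/

/-- [node IUTchIV:Rmk2.3.2(ii) · S/D5 · [IUTchIV] Rmk 2.3.2 (ii), kurims IV p.56 l.35 · p406975 `RemarksCor23Proofs` · claim · DAG status
discharged(p407678)] "the constant 1 … cannot be improved" in its checkable form — PROVED by abc-iut-S-d3. Cited at Step (xi-h). -/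
abbrev N_IUTchIV_Rmk2_3_2_ii : Prop := StatementOf @Literature.IUT.LogVolume.Rmk232.constantOneSharpStatement_holds
/-- discharge of `N_IUTchIV_Rmk2_3_2_ii`: BY NAME; proves nothing new. -/
theorem N_IUTchIV_Rmk2_3_2_ii_holds : N_IUTchIV_Rmk2_3_2_ii := @Literature.IUT.LogVolume.Rmk232.constantOneSharpStatement_holds
example := @Literature.IUT.LogVolume.Rmk232.not_bdLe_of_constantOneSharp

/-- [node AbsTopIII:Prop3.2(iv) · L4/D1 · [AbsTopIII] Prop 3.2 (iv), kurims p.71 · p406795 `MonoidKummerMaps` · FACT-style claims · DAG status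
landed(p406795)] MLF-Galois `TM`-pairs: isomorphisms determined by their Galois part (PROVED by abc-iut-L6-t13, p408132), bijectivity in the
author's corrected form, centre-freeness (named facts). Cited at Step (vi). -/
abbrev N_AbsTopIII_Prop3_2_iv : Prop := Literature.AnabelianGeometry.AbsoluteAnabelian.PairIsoDeterminedByGalois
/-- partial witness of `N_AbsTopIII_Prop3_2_iv` (injectivity clause only; row landed, not discharged): BY NAME; proves nothing new. -/
theorem N_AbsTopIII_Prop3_2_iv_part : N_AbsTopIII_Prop3_2_iv :=
  Literature.AnabelianGeometry.AbsoluteAnabelian.pairIsoDeterminedByGalois_holds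
example := @Literature.AnabelianGeometry.AbsoluteAnabelian.GaloisIsoLiftsToTMPairIso
example := @Literature.AnabelianGeometry.AbsoluteAnabelian.AutPairCenterFree

end

end Summit.ABC.IUTFork.DAG
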